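import Summits.QuantumAdvantage.QuantumAdvantage.Theorems.WalkFiniteState
import Summits.QuantumAdvantage.AdviceFreeQNC0.ChargeRecursion
import Summits.QuantumAdvantage.AdviceFreeQNC0.CleanGapStrategies

/-!
# Rung (G) `Coset21.TwoStepFiniteStateWalkHard 5` — part 1/6 — §1 objects + the four lemma statements, §2 `stub_contraction` (uniform contraction of `P D P`)

VERBATIM split (for the 400-line rule) of planner qa-qnc0-p2 g22's `HOME/qa-qnc0-p2/line22/RungGCore.lean` v3 (sha16 `70defc48ef50f6ad`,
1686 lines, farm rc 0 / 0 sorry; authored AND proved by the planner seat; landed by qn-prover-3 g14, ask P2-22d, `--supports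
stmt-QuantumAdvantage-28072`) into six files `WalkFiniteStateRung{Contraction,Equidist,Transfer,Dense,Sparse}.lean` + `WalkFiniteStateRung.lean`;
only the file boundaries, the per-file preambles, these header lines and one-line docstrings on the planner's undocumented auxiliary
lemmas (lint) are new.  The planner's module docstring follows.

# Cell qa-qnc0 (rung F-Q2-odd, route OddPrimeWalk; support item stmt-QuantumAdvantage-28072 `FiniteStateRungFive`):
# rung (G) — `Coset21.TwoStepFiniteStateWalkHard 5` PROVED (all four lemmas + the composition, sorry-free)

Rung (G) (planner qa-qnc0-p2, ROUND-21 §6 (G), ROUND-22 §1; line card `HOME/qa-qnc0-p2/line22/RUNG-G-LINE.md`): every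
2-step FINITE-STATE strategy mod `p` (tests reading `(wtPrefix u g, wt u) mod p` through an arbitrary table, `Coset21.FinState2`)
wins the `u`-walk game with probability `≤ 2/3 + ε` for large `n` (`Coset21.TwoStepFiniteStateWalkHard p`), for every prime `p ≥ 5`;
in particular `twoStepFiniteStateWalkHard_five : Coset21.TwoStepFiniteStateWalkHard 5` — literally the signature of item
stmt-QuantumAdvantage-28072 (land `--supports stmt-QuantumAdvantage-28072`, then close the item `--as proved --by
Summit.QuantumAdvantage.AdviceFreeQNC0.Coset21.RungG.twoStepFiniteStateWalkHard_five`).  The file realises the checked skeleton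
`HOME/qa-qnc0-p2/line22/RungG.lean` with every stub proved:

* §1 objects (`yOf`, `Active`, `activeCount`, `classOf`, `winIn`, `lazyStep`, `signFlip`) and the four lemma STATEMENTS
  `Equidist`, `SparseBound p`, `Contraction`, `DenseBound p` (verbatim the skeleton);
* §2 **`stub_contraction : Contraction`** with the explicit constant `κ = 1/(32 (M+1)^3)` (norm identities
  `‖P v‖² = ‖v‖² − G v/4`, `‖D w‖ = ‖w‖`, a sign-change edge, discrete Poincaré by induction along the cycle, two cases);
* §3 **`stub_equidist : Equidist`** with the explicit rate `ρ = 1 − 2^{-(M+1)}` (Doeblin: `N_{m+1}(a) = N_m(a) + N_m(a−1)`,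
  the error evolves by the positive operator `T f (a) = f a + f (a−1)`, `M`-step sup-norm contraction on mean-zero vectors, Bernoulli);
* §4 the COMPOSITION `walkHard_of_bounds : SparseBound p → DenseBound p → TwoStepFiniteStateWalkHard p` (per weight class mod `p`:
  few active cuts ⇒ sparse bound, many ⇒ dense bias bound; `twoStepFiniteStateWalkHard_of`, `twoStepFiniteStateWalkHard_five_of`);
* §5 dense-regime tool: norm bookkeeping `sumSq_prodOp_le` for the operator product `D₀ P D₁ P ⋯` (two-at-a-time list recursion,
  `oddTagged` / `tagCount`), `abs_prodOp_apply_le`;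
* §6 dense-regime tool: the TRANSFER IDENTITY `transfer` (cube sum of the signed path product = `2^n ×` operator product; induction
  via `Fin.consEquiv`, `wtPrefix_cons_succ`, `wt_cons`);
* §7 **`stub_dense : Contraction → DenseBound p`** (`M + 1 = 3p`; `proj`, fired-and-live patterns `pat`, `pat_apply_iff`,
  non-constancy of active patterns from the three lifts `x₅ + j p` and `3 ∤ p`, `≤ 3` lifts of a class, `2·#win_{w'} = #class_{w'} − S(w')`,
  `|S(w')| ≤ 2^n (1-κ)^(A/2-1)` by both pairings, fiberwise sum);
* §8 `twoStepFiniteStateWalkHard_of_sparse`, `twoStepFiniteStateWalkHard_five_of_sparse` (the rung from the sparse lemma alone);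
* §9 **`stub_sparse : Equidist → SparseBound p`** (WINDOW CONDITIONING: pigeonhole `exists_free_window` — `(A+1)·m ≤ n` active cuts leave
  a window `[a, a+m)` with no active cut strictly inside; `glue3` fibres `u = uA ++ v ++ uB` (`CleanGapStrategies`); on a fibre WIN is a
  function `WinR` of the window residue `r = wt v mod 3p` (`ringWinU_glue3_iff_winR`); the class fixes `r mod p`, and the three lifts
  `ℓ₀ + j p` do NOT all win (`not_winR_all_three`, from `Coset21.twistedNotAllThree` with twists `p` on cuts `≤ a` and `2p` on cuts
  `≥ a + m`, both `≢ 0 mod 3`); `Equidist` at modulus `3p` makes the three residue counts `2^m/(3p)·(1 ± 3p ρ^m)`, whence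
  `#win ≤ (2/3 + ε)·#class` per fibre (`fibre_bound`) for `2p ρ^m ≤ ε`, summed by `card_filter_eq_sum_glue3`);
* closing theorems `twoStepFiniteStateWalkHard_five` and `twoStepFiniteStateWalkHard_of_prime (p) [Fact p.Prime] (hp : 5 ≤ p)`.

WHAT THIS IS NOT: nothing on `LinSel`/R5 (items 23109/23029) — finite-state tests are a proper subclass of single-residue linear
selections (ROUND-22 §2: the residual (W2)″ is exactly the tables that are NOT functions of two path samples).  No instance, no notation,
no `native_decide`.
-/

noncomputable section

namespace Summit.QuantumAdvantage.AdviceFreeQNC0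

namespace Coset21

namespace RungG

open Finset

/-! ## §1 Objects and the four lemma statements -/


/-- The strategy played by the finite-state table `T` (so `FinState2 p (yOf T)`). -/
def yOf {p n : ℕ} (T : Fin (n + 1) → ZMod p → ZMod p → Bool) : Fin (n + 1) → (Fin n → Bool) → Bool :=
  fun g u => T g ((wtPrefix u g.val : ℕ) : ZMod p) ((wt u : ℕ) : ZMod p)

/-- Auxiliary step `finState2_yOf` of rung (G) (planner qa-qnc0-p2, `RungGCore.lean` v3, verbatim). -/
theorem finState2_yOf {p n : ℕ} (T : Fin (n + 1) → ZMod p → ZMod p → Bool) : FinState2 p (yOf T) :=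
  ⟨T, fun _ _ => rfl⟩

/-- Cut `g` is ACTIVE for the endpoint class `w : ZMod p` iff its table row at `w` is not identically `false`. -/
def Active {p n : ℕ} (T : Fin (n + 1) → ZMod p → ZMod p → Bool) (w : ZMod p) (g : Fin (n + 1)) : Prop :=
  ∃ x : ZMod p, T g x w = true

open Classical in
/-- The number of active cuts for the class `w`. -/
noncomputable def activeCount {p n : ℕ} (T : Fin (n + 1) → ZMod p → ZMod p → Bool) (w : ZMod p) : ℕ :=
  (univ.filter fun g : Fin (n + 1) => Active T w g).card

/-- The endpoint class `{u : wt u ≡ w (mod p)}`. -/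
def classOf (p : ℕ) {n : ℕ} (w : ZMod p) : Finset (Fin n → Bool) :=
  univ.filter fun u : Fin n → Bool => ((wt u : ℕ) : ZMod p) = w

/-- The winning inputs (charge `c`, strategy `yOf T`) inside the class `w`. -/
def winIn {p n : ℕ} (c : ℕ) (T : Fin (n + 1) → ZMod p → ZMod p → Bool) (w : ZMod p) : Finset (Fin n → Bool) :=
  (univ.filter fun u : Fin n → Bool => ringWinU c (yOf T) u = true).filter fun u => ((wt u : ℕ) : ZMod p) = w

/-- Lazy step on `ZMod M`: `(P v) x = (v x + v (x+1)) / 2`. -/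
noncomputable def lazyStep {M : ℕ} (v : ZMod M → ℝ) : ZMod M → ℝ := fun x => (v x + v (x + 1)) / 2

/-- Sign pattern: `(D v) x = ± v x`. -/
noncomputable def signFlip {M : ℕ} (D : ZMod M → Bool) (v : ZMod M → ℝ) : ZMod M → ℝ := fun x => if D x then -v x else v x

/-! ### The four stub statements -/

/-- Lemma 1 (binomial equidistribution mod `M`). -/
def Equidist : Prop :=
  ∀ M : ℕ, 2 ≤ M → ∃ ρ : ℝ, 0 ≤ ρ ∧ ρ < 1 ∧ ∀ (m : ℕ) (a : ZMod M),
    |((((univ : Finset (Fin m → Bool)).filter fun v => ((wt v : ℕ) : ZMod M) = a).card : ℕ) : ℝ) - (2 : ℝ) ^ m / M|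
      ≤ ρ ^ m * (2 : ℝ) ^ m

/-- Lemma 3 (sparse-active regime, relative bound `2/3 + ε` inside a class with few active cuts). -/
def SparseBound (p : ℕ) : Prop :=
  ∀ ε : ℝ, 0 < ε → ∃ m : ℕ, 0 < m ∧ ∀ (n c : ℕ) (T : Fin (n + 1) → ZMod p → ZMod p → Bool) (w : ZMod p),
    (activeCount T w + 1) * m ≤ n →
      ((winIn c T w).card : ℝ) ≤ (2 / 3 + ε) * ((classOf p w : Finset (Fin n → Bool)).card : ℝ)

/-- Lemma 5 (finite-state parity contraction, uniform over non-constant sign patterns, every modulus `M + 1`). -/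
def Contraction : Prop :=
  ∀ M : ℕ, ∃ κ : ℝ, 0 < κ ∧ κ ≤ 1 ∧ ∀ D : ZMod (M + 1) → Bool, (∃ x y, D x ≠ D y) →
    ∀ v : ZMod (M + 1) → ℝ,
      ∑ x, (lazyStep (signFlip D (lazyStep v)) x) ^ 2 ≤ (1 - κ) ^ 2 * ∑ x, (v x) ^ 2

/-- Lemmas 4 + 6 (dense-active regime: transfer operator, bias `≤ 3/2 · 2^n · (1-κ)^(N/2-1)` inside a class with `N` active cuts). -/
def DenseBound (p : ℕ) : Prop :=
  ∃ κ : ℝ, 0 < κ ∧ κ ≤ 1 ∧ ∀ (n c : ℕ) (T : Fin (n + 1) → ZMod p → ZMod p → Bool) (w : ZMod p),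
    |((winIn c T w).card : ℝ) - ((classOf p w : Finset (Fin n → Bool)).card : ℝ) / 2|
      ≤ 3 / 2 * (2 : ℝ) ^ n * (1 - κ) ^ (activeCount T w / 2 - 1)

/-! ## §2 Lemma 5: uniform contraction of `P D P` (explicit `κ`) -/

/-! ### Gradient energy and the two norm identities -/

variable {M : ℕ}

/-- Gradient energy `G v = Σ_x (v x − v (x+1))²`. -/
def grad (v : ZMod (M + 1) → ℝ) : ℝ := ∑ x, (v x - v (x + 1)) ^ 2

/-- Auxiliary step `grad_nonneg` of rung (G) (planner qa-qnc0-p2, `RungGCore.lean` v3, verbatim). -/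
theorem grad_nonneg (v : ZMod (M + 1) → ℝ) : 0 ≤ grad v :=
  Finset.sum_nonneg fun _ _ => sq_nonneg _

/-- Auxiliary step `sum_sq_shift` of rung (G) (planner qa-qnc0-p2, `RungGCore.lean` v3, verbatim). -/
theorem sum_sq_shift (v : ZMod (M + 1) → ℝ) : ∑ x, (v (x + 1)) ^ 2 = ∑ x, (v x) ^ 2 :=
  Fintype.sum_equiv (Equiv.addRight (1 : ZMod (M + 1))) _ _ fun _ => rfl

/-- `‖P v‖² = ‖v‖² − G v / 4`. -/
theorem sum_lazyStep_sq (v : ZMod (M + 1) → ℝ) :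
    ∑ x, (lazyStep v x) ^ 2 = ∑ x, (v x) ^ 2 - grad v / 4 := by
  have h : ∀ x, (lazyStep v x) ^ 2 = ((v x) ^ 2 / 2 + (v (x + 1)) ^ 2 / 2) - (v x - v (x + 1)) ^ 2 / 4 := by
    intro x; simp only [lazyStep]; ring
  simp_rw [h]
  rw [Finset.sum_sub_distrib, Finset.sum_add_distrib, ← Finset.sum_div, ← Finset.sum_div, ← Finset.sum_div,
    sum_sq_shift]
  unfold grad
  ring

/-- `‖D w‖² = ‖w‖²`. -/
theorem sum_signFlip_sq (D : ZMod (M + 1) → Bool) (w : ZMod (M + 1) → ℝ) :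
    ∑ x, (signFlip D w x) ^ 2 = ∑ x, (w x) ^ 2 := by
  refine Finset.sum_congr rfl fun x _ => ?_
  simp only [signFlip]
  split_ifs
  · ring
  · rfl

/-- At a sign change of `D`, the gradient energy of `D w` sees the SUM `w x₀ + w (x₀+1)`. -/
theorem sq_add_le_grad_signFlip (D : ZMod (M + 1) → Bool) (w : ZMod (M + 1) → ℝ) (x₀ : ZMod (M + 1))
    (h : D x₀ ≠ D (x₀ + 1)) : (w x₀ + w (x₀ + 1)) ^ 2 ≤ grad (signFlip D w) := by
  have hterm : (signFlip D w x₀ - signFlip D w (x₀ + 1)) ^ 2 = (w x₀ + w (x₀ + 1)) ^ 2 := by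
    simp only [signFlip]
    split_ifs with h0 h1 h1
    · exact absurd (h0.trans h1.symm) h
    · ring
    · ring
    · exact absurd ((eq_false_of_ne_true h0).trans (eq_false_of_ne_true h1).symm) h
  unfold grad
  rw [← hterm]
  exact Finset.single_le_sum (f := fun x => (signFlip D w x - signFlip D w (x + 1)) ^ 2)
    (fun x _ => sq_nonneg _) (Finset.mem_univ x₀)

/-- A non-constant sign pattern on the cycle changes sign across some edge. -/
theorem exists_edge (D : ZMod (M + 1) → Bool) (h : ∃ x y, D x ≠ D y) : ∃ x₀, D x₀ ≠ D (x₀ + 1) := by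
  by_contra hc
  simp only [not_exists, ne_eq, Decidable.not_not] at hc
  have hall : ∀ k : ℕ, D (k : ZMod (M + 1)) = D 0 := by
    intro k
    induction k with
    | zero => simp
    | succ k ih => rw [Nat.cast_succ, ← hc, ih]
  obtain ⟨x, y, hxy⟩ := h
  apply hxy
  rw [← ZMod.natCast_zmod_val x, ← ZMod.natCast_zmod_val y, hall, hall]

/-! ### Discrete Poincaré inequality on the cycle (by induction along a path) -/

/-- Auxiliary step `abs_path_le` of rung (G) (planner qa-qnc0-p2, `RungGCore.lean` v3, verbatim). -/
theorem abs_path_le (v : ZMod (M + 1) → ℝ) (y : ZMod (M + 1)) :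
    ∀ k : ℕ, |v y - v (y + k)| ≤ k * Real.sqrt (grad v) := by
  intro k
  induction k with
  | zero => simp
  | succ k ih =>
    have hb : |v (y + k) - v (y + k + 1)| ≤ Real.sqrt (grad v) := by
      apply Real.abs_le_sqrt
      unfold grad
      exact Finset.single_le_sum (f := fun x => (v x - v (x + 1)) ^ 2) (fun x _ => sq_nonneg _)
        (Finset.mem_univ (y + k))
    have e : v y - v (y + ((k + 1 : ℕ) : ZMod (M + 1))) =
        (v y - v (y + k)) + (v (y + k) - v (y + k + 1)) := by
      push_cast; rw [← add_assoc]; ring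
    rw [e]
    calc |(v y - v (y + k)) + (v (y + k) - v (y + k + 1))|
        ≤ |v y - v (y + k)| + |v (y + k) - v (y + k + 1)| := abs_add_le _ _
      _ ≤ k * Real.sqrt (grad v) + Real.sqrt (grad v) := add_le_add ih hb
      _ = ((k + 1 : ℕ) : ℝ) * Real.sqrt (grad v) := by push_cast; ring

/-- Auxiliary step `sq_sub_le_grad` of rung (G) (planner qa-qnc0-p2, `RungGCore.lean` v3, verbatim). -/
theorem sq_sub_le_grad (v : ZMod (M + 1) → ℝ) (y x : ZMod (M + 1)) :
    (v x - v y) ^ 2 ≤ ((M : ℝ) + 1) ^ 2 * grad v := by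
  set k : ℕ := (x - y).val with hk
  have hx : y + (k : ZMod (M + 1)) = x := by
    rw [hk, ZMod.natCast_zmod_val]; abel
  have hkN : (k : ℝ) ≤ (M : ℝ) + 1 := by
    have : k < M + 1 := ZMod.val_lt _
    exact_mod_cast this.le
  have h1 : |v y - v x| ≤ ((M : ℝ) + 1) * Real.sqrt (grad v) := by
    have := abs_path_le v y k
    rw [hx] at this
    exact this.trans (mul_le_mul_of_nonneg_right hkN (Real.sqrt_nonneg _))
  have h2 : |v y - v x| ^ 2 ≤ (((M : ℝ) + 1) * Real.sqrt (grad v)) ^ 2 :=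
    pow_le_pow_left₀ (abs_nonneg _) h1 2
  rw [sq_abs, mul_pow, Real.sq_sqrt (grad_nonneg v)] at h2
  calc (v x - v y) ^ 2 = (v y - v x) ^ 2 := by ring
    _ ≤ ((M : ℝ) + 1) ^ 2 * grad v := h2

/-! ### The key dichotomy and the theorem -/

/-- KEY: `G v + G (D P v) ≥ ‖v‖² / (4 N³)` for a non-constant sign pattern (`N = M + 1`). -/
theorem key_lower_bound (D : ZMod (M + 1) → Bool) (x₀ : ZMod (M + 1)) (hx₀ : D x₀ ≠ D (x₀ + 1))
    (v : ZMod (M + 1) → ℝ) :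
    (1 / (4 * ((M : ℝ) + 1) ^ 3)) * ∑ x, (v x) ^ 2 ≤ grad v + grad (signFlip D (lazyStep v)) := by
  set S : ℝ := ∑ x, (v x) ^ 2 with hS_def
  set G : ℝ := grad v with hG_def
  have hN : (0 : ℝ) < (M : ℝ) + 1 := by positivity
  have hN1 : (1 : ℝ) ≤ (M : ℝ) + 1 := by linarith [(Nat.cast_nonneg M : (0 : ℝ) ≤ M)]
  have hS : 0 ≤ S := Finset.sum_nonneg fun x _ => sq_nonneg _
  have hG : 0 ≤ G := grad_nonneg v
  have hGw : 0 ≤ grad (signFlip D (lazyStep v)) := grad_nonneg _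
  set t : ℝ := 1 / (4 * ((M : ℝ) + 1) ^ 3) with ht
  have ht0 : 0 < t := by positivity
  by_cases hA : t * S ≤ G
  · linarith
  rw [not_le] at hA
  -- Case B: `G < t S`; then `v` is nearly constant around `y = x₀ + 1`.
  set y : ZMod (M + 1) := x₀ + 1 with hy
  set A : ℝ := v y with hA_def
  -- (B1) every deviation from `v y` is small
  have hdev : ∀ x, (v x - A) ^ 2 ≤ ((M : ℝ) + 1) ^ 2 * G := fun x => sq_sub_le_grad v y x
  -- (B2)+(B3): `S ≤ 2 N A² + 2 N³ G`
  have hsum : S ≤ 2 * ((M : ℝ) + 1) * A ^ 2 + 2 * (((M : ℝ) + 1) * (((M : ℝ) + 1) ^ 2 * G)) := by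
    have hpt : ∀ x ∈ (univ : Finset (ZMod (M + 1))), (v x) ^ 2 ≤ 2 * A ^ 2 + 2 * (v x - A) ^ 2 := by
      intro x _; nlinarith [sq_nonneg (v x - 2 * A)]
    have h1 : S ≤ ∑ x, (2 * A ^ 2 + 2 * (v x - A) ^ 2) := Finset.sum_le_sum hpt
    have h2 : ∑ x : ZMod (M + 1), (2 * A ^ 2 + 2 * (v x - A) ^ 2)
        = 2 * ((M : ℝ) + 1) * A ^ 2 + 2 * ∑ x : ZMod (M + 1), (v x - A) ^ 2 := by
      rw [Finset.sum_add_distrib, Finset.sum_const, Finset.card_univ, ZMod.card, ← Finset.mul_sum]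
      simp [nsmul_eq_mul]
      ring
    have h3 : ∑ x : ZMod (M + 1), (v x - A) ^ 2 ≤ ((M : ℝ) + 1) * (((M : ℝ) + 1) ^ 2 * G) := by
      have := Finset.sum_le_card_nsmul (univ : Finset (ZMod (M + 1))) (fun x => (v x - A) ^ 2)
        (((M : ℝ) + 1) ^ 2 * G) (fun x _ => hdev x)
      rw [Finset.card_univ, ZMod.card, nsmul_eq_mul] at this
      push_cast at this
      exact this
    linarith
  -- hence `A² ≥ S/(4N)` (in the multiplied-out form `2 N A² ≥ S - 2 N³ G > S/2`)
  have hN3G : ((M : ℝ) + 1) ^ 3 * G < S / 4 := by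
    have : ((M : ℝ) + 1) ^ 3 * (t * S) = S / 4 := by
      rw [ht]; field_simp
    have h' : ((M : ℝ) + 1) ^ 3 * G < ((M : ℝ) + 1) ^ 3 * (t * S) :=
      mul_lt_mul_of_pos_left hA (by positivity)
    linarith
  have hA2 : S / 4 < ((M : ℝ) + 1) * A ^ 2 := by nlinarith
  -- (B4) the sign-change edge: `G (D P v) ≥ (P v x₀ + P v (x₀+1))² = (2A + d)²`, `d = (d₁ + d₂)/2`
  have hedge := sq_add_le_grad_signFlip D (lazyStep v) x₀ hx₀
  have hPv : lazyStep v x₀ + lazyStep v (x₀ + 1) = 2 * A + ((v x₀ - A) + (v (x₀ + 1 + 1) - A)) / 2 := by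
    simp only [lazyStep, hA_def, hy]; ring
  rw [hPv] at hedge
  set d : ℝ := ((v x₀ - A) + (v (x₀ + 1 + 1) - A)) / 2 with hd
  have hd1 : (v x₀ - A) ^ 2 ≤ ((M : ℝ) + 1) ^ 2 * G := hdev x₀
  have hd2 : (v (x₀ + 1 + 1) - A) ^ 2 ≤ ((M : ℝ) + 1) ^ 2 * G := hdev (x₀ + 1 + 1)
  have hdsq : d ^ 2 ≤ ((M : ℝ) + 1) ^ 2 * G := by
    rw [hd]; nlinarith [sq_nonneg ((v x₀ - A) - (v (x₀ + 1 + 1) - A))]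
  -- `N² G ≤ N³ G < S/4 < N A²`, so `d² < N A²`... we need `d² ≤ A²`: use `N² G · N ≤ N³ G < S/4 < N A²` and divide by N
  have hdA : d ^ 2 ≤ A ^ 2 := by
    have h1 : ((M : ℝ) + 1) * d ^ 2 ≤ ((M : ℝ) + 1) ^ 3 * G := by nlinarith
    have h2 : ((M : ℝ) + 1) * d ^ 2 < ((M : ℝ) + 1) * A ^ 2 := by linarith
    exact (lt_of_mul_lt_mul_left h2 hN.le).le
  -- `(2A + d)² ≥ A²` since `3A² + 4Ad + d² = (A² − d²) + 2(A + d)² ≥ 0`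
  have hsq : A ^ 2 ≤ (2 * A + d) ^ 2 := by nlinarith [sq_nonneg (A + d)]
  -- and `A² > S/(4N) ≥ t S` because `N² ≥ 1`
  have htS : t * S ≤ A ^ 2 := by
    have h1 : t * S = S / 4 / ((M : ℝ) + 1) ^ 3 := by rw [ht]; field_simp
    have hpow : (M : ℝ) + 1 ≤ ((M : ℝ) + 1) ^ 3 := by nlinarith [pow_le_pow_left₀ zero_le_one hN1 2]
    have h2 : S / 4 / ((M : ℝ) + 1) ^ 3 ≤ S / 4 / ((M : ℝ) + 1) :=
      div_le_div_of_nonneg_left (by positivity) hN hpow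
    have h3 : S / 4 / ((M : ℝ) + 1) < A ^ 2 := by rw [div_lt_iff₀ hN]; linarith
    linarith
  linarith

/-- **`stub_contraction` of the rung-(G) skeleton — PROVED**, with `κ = 1/(32 (M+1)³)`. -/
theorem stub_contraction : Contraction := by
  intro M
  have hN : (0 : ℝ) < (M : ℝ) + 1 := by positivity
  have hN1 : (1 : ℝ) ≤ (M : ℝ) + 1 := by linarith [(Nat.cast_nonneg M : (0 : ℝ) ≤ M)]
  refine ⟨1 / (32 * ((M : ℝ) + 1) ^ 3), by positivity, ?_, ?_⟩
  · rw [div_le_one (by positivity)]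
    have h3 : (1 : ℝ) ≤ ((M : ℝ) + 1) ^ 3 := by simpa using pow_le_pow_left₀ zero_le_one hN1 3
    linarith
  · intro D hD v
    obtain ⟨x₀, hx₀⟩ := exists_edge D hD
    have key := key_lower_bound D x₀ hx₀ v
    have hS : 0 ≤ ∑ x, (v x) ^ 2 := Finset.sum_nonneg fun x _ => sq_nonneg _
    rw [sum_lazyStep_sq, sum_signFlip_sq, sum_lazyStep_sq]
    set S : ℝ := ∑ x, (v x) ^ 2
    set t : ℝ := 1 / (4 * ((M : ℝ) + 1) ^ 3) with ht
    have hκ : 1 / (32 * ((M : ℝ) + 1) ^ 3) = t / 8 := by rw [ht]; field_simp; ring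
    rw [hκ]
    have ht0 : 0 ≤ t := by positivity
    nlinarith [key, hS, mul_nonneg (mul_nonneg ht0 ht0) hS, grad_nonneg v,
      grad_nonneg (signFlip D (lazyStep v))]


end RungG

end Coset21

end Summit.QuantumAdvantage.AdviceFreeQNC0
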